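import Literature.Computability.Learning.LearnerTablesFP
import HarnessLib

/-!
# The learner's hypothesis assembly in `FP`

Machine-layer instalment (M8d) of the decomposition of the named fact
`Literature.Computability.Learning.cikk_natural_implies_learning` (CIKK 2016, Thm. 5.1): from the
parameter record `PRM = ⟨1ⁿ, ⟨1ᵏ, ⟨1^ℓ, ⟨1ᴸ, ⟨1^kk, ⟨1^{2^kk}, ⟨1ᵗ, ⟨1^q, 1^κ⟩⟩⟩⟩⟩⟩⟩⟩`, the coin
segment of one run (layout `[i : ℓ | z : q² | w : L | sd : kk·k | σ : kk | Pb : k | a : kn |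
steps : t·(κ + kn)]`) and the run's membership answers, the string function `hypFn` assembles
exactly the hypothesis record `hypRec` (`EvalFP.lean`) of the run with coins `coinsToRun seg`
and the learner's tables.

## References

* M. Carmosino, R. Impagliazzo, V. Kabanets, A. Kolokolova, *Learning algorithms from natural
  proofs*, CCC 2016, §5 (complete algorithm) [CarmosinoImpagliazzoKabanetsKolokolova2016].
-/

open Polynomial

namespace Literature.Computability.Learning

open Literature.Computability.Complexity Literature.Computability.Complexity.Brick
  Literature.Computability.Complexity.Plumb Literature.Computability.MetaComplexity
  Literature.Computability.Cryptography _root_.Computability Finset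

/-! ### Layout of the coin segment of one run -/

section Layout

variable (n k ℓ kk t q κ : ℕ)

/-- Offset of `w`. [folklore] -/
def offW : ℕ := ℓ + q * q
/-- Offset of the seeds `sd`. [folklore] -/
def offSd : ℕ := offW ℓ q + 2 ^ ℓ
/-- Offset of the guesses `σ`. [folklore] -/
def offSg : ℕ := offSd ℓ q + kk * k
/-- Offset of the trusted-position bits `Pb`. [folklore] -/
def offPb : ℕ := offSg k ℓ kk q + kk
/-- Offset of the trusted tuple `a`. [folklore] -/
def offA : ℕ := offPb k ℓ kk q + k
/-- Offset of the steps. [folklore] -/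
def offSt : ℕ := offA k ℓ kk q + k * n
/-- Length of one step `(j, y)`: `κ + kn` bits. [folklore] -/
def stepLen : ℕ := κ + k * n
/-- **Length of the coin segment of one run.** [folklore] -/
def runLen : ℕ := offSt n k ℓ kk q + t * stepLen n k κ

end Layout

/-- Reading `len` bits at offset `o`. [folklore] -/
def readBits (seg : List Bool) (o len : ℕ) : Fin len → Bool := fun p => seg.getD (o + p) false

/-- A slice of a long enough string lists `readBits`. [folklore] -/
theorem drop_take_eq_ofFn_readBits (seg : List Bool) {o len : ℕ} (h : o + len ≤ seg.length) :
    (seg.drop o).take len = List.ofFn (readBits seg o len) := by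
  apply List.ext_getElem
  · simp; omega
  · intro p h1 h2
    rw [List.length_ofFn] at h2
    rw [List.getElem_take, List.getElem_drop, List.getElem_ofFn, readBits, List.getD_eq_getElem]

/-- The slice `[o, o + len)` of a string. [folklore] -/
def slice (seg : List Bool) (o len : ℕ) : List Bool := (seg.drop o).take len

/-- **The run coins read off a coin segment** (layout above; `j_r = ⟦κ bits⟧ mod k`), each field
in the form in which the machine slices it. [folklore] -/
noncomputable def coinsToRun (n k ℓ kk t q κ : ℕ) (hk : 0 < k) (seg : List Bool) : RunCoins n k (2 ^ ℓ) (q * q) kk t :=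
  ((boolFunEquivFin ℓ (readBits seg 0 ℓ), readBits seg ℓ (q * q), readBits seg (offW ℓ q) (2 ^ ℓ)),
   (fun s p => boolToZMod ((slice seg (offSd ℓ q) (kk * k)).getD (s * k + p) false),
    fun s => boolToZMod ((slice seg (offSg k ℓ kk q) kk).getD s false)),
   (readBits seg (offPb k ℓ kk q) k,
    fun blk d => (slice seg (offA k ℓ kk q) (k * n)).getD (blk * n + d) false,
    fun r => (⟨bitsToNat (List.ofFn (readBits (slice seg (offSt n k ℓ kk q) (t * stepLen n k κ)) (r * stepLen n k κ) κ)) % k,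
        Nat.mod_lt _ hk⟩,
      fun blk d => (slice seg (offSt n k ℓ kk q) (t * stepLen n k κ)).getD (r * stepLen n k κ + κ + (blk * n + d)) false)))

/-- The parameter record `⟨1ⁿ, ⟨1ᵏ, ⟨1^ℓ, ⟨1ᴸ, ⟨1^kk, ⟨1^{KK}, ⟨1ᵗ, ⟨1^q, 1^κ⟩⟩⟩⟩⟩⟩⟩⟩`. [folklore] -/
def prmRec (n k ℓ L kk KK t q κ : ℕ) : List Bool :=
  boolPair (ones n) (boolPair (ones k) (boolPair (ones ℓ) (boolPair (ones L) (boolPair (ones kk) (boolPair (ones KK)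
    (boolPair (ones t) (boolPair (ones q) (ones κ))))))))

/-! ### The steps -/

/-- The piece of the steps fold on `⟨⟨SC, stbits⟩, 1ʳ⟩`, `SC = ⟨1ᵏ, ⟨1^κ, ⟨1^{kn}, 1ᵗ⟩⟩⟩`: the item `⟨1^{j_r}, ybits_r⟩`. [folklore] -/
noncomputable def stepsPiece : List Bool → List Bool :=
  (fanoutFn (fanoutFn (binToUnaryFn ∘ (fanoutFn (nthF 0 ∘ (fstF ∘ fstF)) (takeFn ∘ (fanoutFn (nthF 1 ∘ (fstF ∘ fstF)) (dropFn ∘ (fanoutFn (HashBricks.umulFn ∘ (fanoutFn sndF (appF ∘ (fanoutFn (nthF 1 ∘ (fstF ∘ fstF)) (nthF 2 ∘ (fstF ∘ fstF)))))) (sndF ∘ fstF))))))) (takeFn ∘ (fanoutFn (nthF 2 ∘ (fstF ∘ fstF)) (dropFn ∘ (fanoutFn (appF ∘ (fanoutFn (HashBricks.umulFn ∘ (fanoutFn sndF (appF ∘ (fanoutFn (nthF 1 ∘ (fstF ∘ fstF)) (nthF 2 ∘ (fstF ∘ fstF)))))) (nthF 1 ∘ (fstF ∘ fstF)))) (sndF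 ∘ fstF)))))) (fun _ => []))

/-- `stepsPiece ∈ FP`. [folklore] -/
theorem stepsPiece_mem_FP : stepsPiece ∈ FP :=
  (fanoutFn_mem_FP (fanoutFn_mem_FP (comp_mem_FP binToUnaryFn_mem_FP (fanoutFn_mem_FP (comp_mem_FP (nthF_mem_FP 0) (comp_mem_FP fstF_mem_FP fstF_mem_FP)) (comp_mem_FP takeFn_mem_FP (fanoutFn_mem_FP (comp_mem_FP (nthF_mem_FP 1) (comp_mem_FP fstF_mem_FP fstF_mem_FP)) (comp_mem_FP dropFn_mem_FP (fanoutFn_mem_FP (comp_mem_FP HashBricks.umulFn_mem_FP (fanoutFn_mem_FP sndF_mem_FP (comp_mem_FP appF_mem_FP (fanoutFn_mem_FP (comp_mem_FP (nthF_mem_FP 1) (comp_mem_FP fstF_mem_FP fstF_mem_FP)) (comp_mem_FP (nthF_mem_FP 2) (comp_mem_FP fstF_mem_FP fstF_mem_FP)))))) (comp_mem_FP sndF_mem_FP fstF_mem_FP))))))) (comp_mem_FP takeFn_mem_FP (fanoutFn_mem_FP (comp_mem_FP (nthF_mem_FP 2) (comp_mem_FP fstF_mem_FP fstF_mem_FP))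 (comp_mem_FP dropFn_mem_FP (fanoutFn_mem_FP (comp_mem_FP appF_mem_FP (fanoutFn_mem_FP (comp_mem_FP HashBricks.umulFn_mem_FP (fanoutFn_mem_FP sndF_mem_FP (comp_mem_FP appF_mem_FP (fanoutFn_mem_FP (comp_mem_FP (nthF_mem_FP 1) (comp_mem_FP fstF_mem_FP fstF_mem_FP)) (comp_mem_FP (nthF_mem_FP 2) (comp_mem_FP fstF_mem_FP fstF_mem_FP)))))) (comp_mem_FP (nthF_mem_FP 1) (comp_mem_FP fstF_mem_FP fstF_mem_FP)))) (comp_mem_FP sndF_mem_FP fstF_mem_FP)))))) (const_mem_FP _))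

/-- **The list code of the steps** `⟨1^{j_r}, ybits_r⟩`, `r < t`, on `⟨SC, stbits⟩`. [folklore] -/
noncomputable def stepsFn : List Bool → List Bool :=
  (sndPow 2 ∘ (foldLoop appF (clipF 3 stepsPiece) X ∘ (fanoutFn id (fanoutFn (lenBinF ∘ (sndPow 2 ∘ fstF)) (fun _ => boolPair [] [])))))

/-- `stepsFn ∈ FP`. [folklore] -/
theorem stepsFn_mem_FP : stepsFn ∈ FP :=
  (comp_mem_FP (sndPow_mem_FP 2) (comp_mem_FP (foldLoop_clipF_mem_FP 3 appF_mem_FP length_appF_le stepsPiece_mem_FP X) (fanoutFn_mem_FP (PolyTimeComputable.id _) (fanoutFn_mem_FP (comp_mem_FP lenBinF_mem_FP (comp_mem_FP (sndPow_mem_FP 2) fstF_mem_FP)) (const_mem_FP _)))))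

/-- **The hypothesis record of one run** assembled from the parameter record, the coin segment and the answers, on `HR = ⟨PRM, ⟨seg, ans⟩⟩`. [cite: CarmosinoImpagliazzoKabanetsKolokolova2016, §5 (complete algorithm)] -/
noncomputable def hypFn : List Bool → List Bool :=
  (fanoutFn (fanoutFn (fanoutFn (fanoutFn (fun _ => []) (fanoutFn (nthF 7 ∘ fstF) (fanoutFn (nthF 2 ∘ fstF) (fanoutFn (appF ∘ (fanoutFn (HashBricks.umulFn ∘ (fanoutFn (nthF 1 ∘ fstF) (nthF 0 ∘ fstF))) (nthF 1 ∘ fstF))) (nthF 3 ∘ fstF))))) (fanoutFn (takeFn ∘ (fanoutFn (nthF 2 ∘ fstF) (dropFn ∘ (fanoutFn (fun _ => []) (fstF ∘ sndF))))) (fanoutFn (takeFn ∘ (fanoutFn (nthF 3 ∘ fstF) (dropFn ∘ (fanoutFn (appF ∘ (fanoutFn (nthF 2 ∘ fstF) (HashBricks.umulFn ∘ (fanoutFn (nthF 7 ∘ fstF) (nthF 7 ∘ fstF))))) (fstF ∘ sndF))))) (fanoutFn (tablesFn ∘ (fanoutFn (fanoutFn (fanoutFn (fun _ => []) (fanoutFn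 (nthF 7 ∘ fstF) (fanoutFn (nthF 2 ∘ fstF) (fanoutFn (appF ∘ (fanoutFn (HashBricks.umulFn ∘ (fanoutFn (nthF 1 ∘ fstF) (nthF 0 ∘ fstF))) (nthF 1 ∘ fstF))) (nthF 3 ∘ fstF))))) (fanoutFn (takeFn ∘ (fanoutFn (nthF 2 ∘ fstF) (dropFn ∘ (fanoutFn (fun _ => []) (fstF ∘ sndF))))) (fanoutFn (takeFn ∘ (fanoutFn (HashBricks.umulFn ∘ (fanoutFn (nthF 7 ∘ fstF) (nthF 7 ∘ fstF))) (dropFn ∘ (fanoutFn (nthF 2 ∘ fstF) (fstF ∘ sndF))))) (fanoutFn (nthF 0 ∘ fstF) (nthF 1 ∘ fstF))))) (sndF ∘ sndF))) (takeFn ∘ (fanoutFn (HashBricks.umulFn ∘ (fanoutFn (nthF 7 ∘ fstF) (nthF 7 ∘ fstF))) (dropFn ∘ (fanoutFn (nthF 2 ∘ fstF) (fstF ∘ sndF))))))))) (fanoutFn (fanoutFn (nthF 0 ∘ fstF) (fanoutFn (nthF 1 ∘ fstF) (fanoutFn (nthF 4 ∘ fstF) (nthF 5 ∘ fstF)))) (fanoutFn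 (takeFn ∘ (fanoutFn (HashBricks.umulFn ∘ (fanoutFn (nthF 4 ∘ fstF) (nthF 1 ∘ fstF))) (dropFn ∘ (fanoutFn (appF ∘ (fanoutFn (appF ∘ (fanoutFn (nthF 2 ∘ fstF) (HashBricks.umulFn ∘ (fanoutFn (nthF 7 ∘ fstF) (nthF 7 ∘ fstF))))) (nthF 3 ∘ fstF))) (fstF ∘ sndF))))) (takeFn ∘ (fanoutFn (nthF 4 ∘ fstF) (dropFn ∘ (fanoutFn (appF ∘ (fanoutFn (appF ∘ (fanoutFn (appF ∘ (fanoutFn (nthF 2 ∘ fstF) (HashBricks.umulFn ∘ (fanoutFn (nthF 7 ∘ fstF) (nthF 7 ∘ fstF))))) (nthF 3 ∘ fstF))) (HashBricks.umulFn ∘ (fanoutFn (nthF 4 ∘ fstF) (nthF 1 ∘ fstF))))) (fstF ∘ sndF)))))))) (fanoutFn (fanoutFn (nthF 0 ∘ fstF) (fanoutFn (nthF 1 ∘ fstF) (nthF 6 ∘ fstF))) (fanoutFn (takeFn ∘ (fanoutFn (nthF 1 ∘ fstF) (dropFn ∘ (fanoutFn (appF ∘ (fanoutFn (appF ∘ (fanoutFn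 (appF ∘ (fanoutFn (appF ∘ (fanoutFn (nthF 2 ∘ fstF) (HashBricks.umulFn ∘ (fanoutFn (nthF 7 ∘ fstF) (nthF 7 ∘ fstF))))) (nthF 3 ∘ fstF))) (HashBricks.umulFn ∘ (fanoutFn (nthF 4 ∘ fstF) (nthF 1 ∘ fstF))))) (nthF 4 ∘ fstF))) (fstF ∘ sndF))))) (fanoutFn (takeFn ∘ (fanoutFn (HashBricks.umulFn ∘ (fanoutFn (nthF 1 ∘ fstF) (nthF 0 ∘ fstF))) (dropFn ∘ (fanoutFn (appF ∘ (fanoutFn (appF ∘ (fanoutFn (appF ∘ (fanoutFn (appF ∘ (fanoutFn (appF ∘ (fanoutFn (nthF 2 ∘ fstF) (HashBricks.umulFn ∘ (fanoutFn (nthF 7 ∘ fstF) (nthF 7 ∘ fstF))))) (nthF 3 ∘ fstF))) (HashBricks.umulFn ∘ (fanoutFn (nthF 4 ∘ fstF) (nthF 1 ∘ fstF))))) (nthF 4 ∘ fstF))) (nthF 1 ∘ fstF))) (fstF ∘ sndF))))) (fanoutFn (takeFn ∘ (fanoutFn (nthF 1 ∘ fstF) (dropFn ∘ (fanoutFn (HashBricks.umulFn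 ∘ (fanoutFn (HashBricks.umulFn ∘ (fanoutFn (nthF 3 ∘ fstF) (nthF 3 ∘ fstF))) (nthF 1 ∘ fstF))) (sndF ∘ sndF))))) (stepsFn ∘ (fanoutFn (fanoutFn (nthF 1 ∘ fstF) (fanoutFn (sndPow 7 ∘ fstF) (fanoutFn (HashBricks.umulFn ∘ (fanoutFn (nthF 1 ∘ fstF) (nthF 0 ∘ fstF))) (nthF 6 ∘ fstF)))) (takeFn ∘ (fanoutFn (HashBricks.umulFn ∘ (fanoutFn (nthF 6 ∘ fstF) (appF ∘ (fanoutFn (sndPow 7 ∘ fstF) (HashBricks.umulFn ∘ (fanoutFn (nthF 1 ∘ fstF) (nthF 0 ∘ fstF))))))) (dropFn ∘ (fanoutFn (appF ∘ (fanoutFn (appF ∘ (fanoutFn (appF ∘ (fanoutFn (appF ∘ (fanoutFn (appF ∘ (fanoutFn (appF ∘ (fanoutFn (nthF 2 ∘ fstF) (HashBricks.umulFn ∘ (fanoutFn (nthF 7 ∘ fstF) (nthF 7 ∘ fstF))))) (nthF 3 ∘ fstF))) (HashBricks.umulFn ∘ (fanoutFn (nthF 4 ∘ fstF) (nthF 1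 ∘ fstF))))) (nthF 4 ∘ fstF))) (nthF 1 ∘ fstF))) (HashBricks.umulFn ∘ (fanoutFn (nthF 1 ∘ fstF) (nthF 0 ∘ fstF))))) (fstF ∘ sndF))))))))))))

/-- `hypFn ∈ FP`. [folklore] -/
theorem hypFn_mem_FP : hypFn ∈ FP :=
  (fanoutFn_mem_FP (fanoutFn_mem_FP (fanoutFn_mem_FP (fanoutFn_mem_FP (const_mem_FP _) (fanoutFn_mem_FP (comp_mem_FP (nthF_mem_FP 7) fstF_mem_FP) (fanoutFn_mem_FP (comp_mem_FP (nthF_mem_FP 2) fstF_mem_FP) (fanoutFn_mem_FP (comp_mem_FP appF_mem_FP (fanoutFn_mem_FP (comp_mem_FP HashBricks.umulFn_mem_FP (fanoutFn_mem_FP (comp_mem_FP (nthF_mem_FP 1) fstF_mem_FP) (comp_mem_FP (nthF_mem_FP 0) fstF_mem_FP))) (comp_mem_FP (nthF_mem_FP 1) fstF_mem_FP))) (comp_mem_FP (nthF_mem_FP 3) fstF_mem_FP))))) (fanoutFn_mem_FP (comp_mem_FP takeFn_mem_FP (fanoutFn_mem_FP (comp_mem_FP (nthF_mem_FP 2) fstF_mem_FP)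 (comp_mem_FP dropFn_mem_FP (fanoutFn_mem_FP (const_mem_FP _) (comp_mem_FP fstF_mem_FP sndF_mem_FP))))) (fanoutFn_mem_FP (comp_mem_FP takeFn_mem_FP (fanoutFn_mem_FP (comp_mem_FP (nthF_mem_FP 3) fstF_mem_FP) (comp_mem_FP dropFn_mem_FP (fanoutFn_mem_FP (comp_mem_FP appF_mem_FP (fanoutFn_mem_FP (comp_mem_FP (nthF_mem_FP 2) fstF_mem_FP) (comp_mem_FP HashBricks.umulFn_mem_FP (fanoutFn_mem_FP (comp_mem_FP (nthF_mem_FP 7) fstF_mem_FP) (comp_mem_FP (nthF_mem_FP 7) fstF_mem_FP))))) (comp_mem_FP fstF_mem_FP sndF_mem_FP))))) (fanoutFn_mem_FP (comp_mem_FP tablesFn_mem_FP (fanoutFn_mem_FP (fanoutFn_mem_FP (fanoutFn_mem_FP (const_mem_FP _) (fanoutFn_mem_FP (comp_mem_FP (nthF_mem_FP 7) fstF_mem_FP) (fanoutFn_mem_FP (comp_mem_FP (nthF_mem_FP 2) fstF_mem_FP) (fanoutFn_mem_FP (comp_mem_FP appF_mem_FP (fanoutFn_mem_FP (comp_mem_FP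 HashBricks.umulFn_mem_FP (fanoutFn_mem_FP (comp_mem_FP (nthF_mem_FP 1) fstF_mem_FP) (comp_mem_FP (nthF_mem_FP 0) fstF_mem_FP))) (comp_mem_FP (nthF_mem_FP 1) fstF_mem_FP))) (comp_mem_FP (nthF_mem_FP 3) fstF_mem_FP))))) (fanoutFn_mem_FP (comp_mem_FP takeFn_mem_FP (fanoutFn_mem_FP (comp_mem_FP (nthF_mem_FP 2) fstF_mem_FP) (comp_mem_FP dropFn_mem_FP (fanoutFn_mem_FP (const_mem_FP _) (comp_mem_FP fstF_mem_FP sndF_mem_FP))))) (fanoutFn_mem_FP (comp_mem_FP takeFn_mem_FP (fanoutFn_mem_FP (comp_mem_FP HashBricks.umulFn_mem_FP (fanoutFn_mem_FP (comp_mem_FP (nthF_mem_FP 7) fstF_mem_FP) (comp_mem_FP (nthF_mem_FP 7) fstF_mem_FP))) (comp_mem_FP dropFn_mem_FP (fanoutFn_mem_FP (comp_mem_FP (nthF_mem_FP 2) fstF_mem_FP) (comp_mem_FP fstF_mem_FP sndF_mem_FP))))) (fanoutFn_mem_FP (comp_mem_FP (nthF_mem_FP 0) fstF_mem_FP) (comp_mem_FP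 (nthF_mem_FP 1) fstF_mem_FP))))) (comp_mem_FP sndF_mem_FP sndF_mem_FP))) (comp_mem_FP takeFn_mem_FP (fanoutFn_mem_FP (comp_mem_FP HashBricks.umulFn_mem_FP (fanoutFn_mem_FP (comp_mem_FP (nthF_mem_FP 7) fstF_mem_FP) (comp_mem_FP (nthF_mem_FP 7) fstF_mem_FP))) (comp_mem_FP dropFn_mem_FP (fanoutFn_mem_FP (comp_mem_FP (nthF_mem_FP 2) fstF_mem_FP) (comp_mem_FP fstF_mem_FP sndF_mem_FP))))))))) (fanoutFn_mem_FP (fanoutFn_mem_FP (comp_mem_FP (nthF_mem_FP 0) fstF_mem_FP) (fanoutFn_mem_FP (comp_mem_FP (nthF_mem_FP 1) fstF_mem_FP) (fanoutFn_mem_FP (comp_mem_FP (nthF_mem_FP 4) fstF_mem_FP) (comp_mem_FP (nthF_mem_FP 5) fstF_mem_FP)))) (fanoutFn_mem_FP (comp_mem_FP takeFn_mem_FP (fanoutFn_mem_FP (comp_mem_FP HashBricks.umulFn_mem_FP (fanoutFn_mem_FP (comp_mem_FP (nthF_mem_FP 4) fstF_mem_FP) (comp_mem_FP (nthF_mem_FP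 1) fstF_mem_FP))) (comp_mem_FP dropFn_mem_FP (fanoutFn_mem_FP (comp_mem_FP appF_mem_FP (fanoutFn_mem_FP (comp_mem_FP appF_mem_FP (fanoutFn_mem_FP (comp_mem_FP (nthF_mem_FP 2) fstF_mem_FP) (comp_mem_FP HashBricks.umulFn_mem_FP (fanoutFn_mem_FP (comp_mem_FP (nthF_mem_FP 7) fstF_mem_FP) (comp_mem_FP (nthF_mem_FP 7) fstF_mem_FP))))) (comp_mem_FP (nthF_mem_FP 3) fstF_mem_FP))) (comp_mem_FP fstF_mem_FP sndF_mem_FP))))) (comp_mem_FP takeFn_mem_FP (fanoutFn_mem_FP (comp_mem_FP (nthF_mem_FP 4) fstF_mem_FP) (comp_mem_FP dropFn_mem_FP (fanoutFn_mem_FP (comp_mem_FP appF_mem_FP (fanoutFn_mem_FP (comp_mem_FP appF_mem_FP (fanoutFn_mem_FP (comp_mem_FP appF_mem_FP (fanoutFn_mem_FP (comp_mem_FP (nthF_mem_FP 2) fstF_mem_FP) (comp_mem_FP HashBricks.umulFn_mem_FP (fanoutFn_mem_FP (comp_mem_FP (nthF_mem_FP 7) fstF_mem_FP) (comp_mem_FP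 (nthF_mem_FP 7) fstF_mem_FP))))) (comp_mem_FP (nthF_mem_FP 3) fstF_mem_FP))) (comp_mem_FP HashBricks.umulFn_mem_FP (fanoutFn_mem_FP (comp_mem_FP (nthF_mem_FP 4) fstF_mem_FP) (comp_mem_FP (nthF_mem_FP 1) fstF_mem_FP))))) (comp_mem_FP fstF_mem_FP sndF_mem_FP)))))))) (fanoutFn_mem_FP (fanoutFn_mem_FP (comp_mem_FP (nthF_mem_FP 0) fstF_mem_FP) (fanoutFn_mem_FP (comp_mem_FP (nthF_mem_FP 1) fstF_mem_FP) (comp_mem_FP (nthF_mem_FP 6) fstF_mem_FP))) (fanoutFn_mem_FP (comp_mem_FP takeFn_mem_FP (fanoutFn_mem_FP (comp_mem_FP (nthF_mem_FP 1) fstF_mem_FP) (comp_mem_FP dropFn_mem_FP (fanoutFn_mem_FP (comp_mem_FP appF_mem_FP (fanoutFn_mem_FP (comp_mem_FP appF_mem_FP (fanoutFn_mem_FP (comp_mem_FP appF_mem_FP (fanoutFn_mem_FP (comp_mem_FP appF_mem_FP (fanoutFn_mem_FP (comp_mem_FP (nthF_mem_FP 2) fstF_mem_FP) (comp_mem_FP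 HashBricks.umulFn_mem_FP (fanoutFn_mem_FP (comp_mem_FP (nthF_mem_FP 7) fstF_mem_FP) (comp_mem_FP (nthF_mem_FP 7) fstF_mem_FP))))) (comp_mem_FP (nthF_mem_FP 3) fstF_mem_FP))) (comp_mem_FP HashBricks.umulFn_mem_FP (fanoutFn_mem_FP (comp_mem_FP (nthF_mem_FP 4) fstF_mem_FP) (comp_mem_FP (nthF_mem_FP 1) fstF_mem_FP))))) (comp_mem_FP (nthF_mem_FP 4) fstF_mem_FP))) (comp_mem_FP fstF_mem_FP sndF_mem_FP))))) (fanoutFn_mem_FP (comp_mem_FP takeFn_mem_FP (fanoutFn_mem_FP (comp_mem_FP HashBricks.umulFn_mem_FP (fanoutFn_mem_FP (comp_mem_FP (nthF_mem_FP 1) fstF_mem_FP) (comp_mem_FP (nthF_mem_FP 0) fstF_mem_FP))) (comp_mem_FP dropFn_mem_FP (fanoutFn_mem_FP (comp_mem_FP appF_mem_FP (fanoutFn_mem_FP (comp_mem_FP appF_mem_FP (fanoutFn_mem_FP (comp_mem_FP appF_mem_FP (fanoutFn_mem_FP (comp_mem_FP appF_mem_FP (fanoutFn_mem_FP (comp_mem_FP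 appF_mem_FP (fanoutFn_mem_FP (comp_mem_FP (nthF_mem_FP 2) fstF_mem_FP) (comp_mem_FP HashBricks.umulFn_mem_FP (fanoutFn_mem_FP (comp_mem_FP (nthF_mem_FP 7) fstF_mem_FP) (comp_mem_FP (nthF_mem_FP 7) fstF_mem_FP))))) (comp_mem_FP (nthF_mem_FP 3) fstF_mem_FP))) (comp_mem_FP HashBricks.umulFn_mem_FP (fanoutFn_mem_FP (comp_mem_FP (nthF_mem_FP 4) fstF_mem_FP) (comp_mem_FP (nthF_mem_FP 1) fstF_mem_FP))))) (comp_mem_FP (nthF_mem_FP 4) fstF_mem_FP))) (comp_mem_FP (nthF_mem_FP 1) fstF_mem_FP))) (comp_mem_FP fstF_mem_FP sndF_mem_FP))))) (fanoutFn_mem_FP (comp_mem_FP takeFn_mem_FP (fanoutFn_mem_FP (comp_mem_FP (nthF_mem_FP 1) fstF_mem_FP) (comp_mem_FP dropFn_mem_FP (fanoutFn_mem_FP (comp_mem_FP HashBricks.umulFn_mem_FP (fanoutFn_mem_FP (comp_mem_FP HashBricks.umulFn_mem_FP (fanoutFn_mem_FP (comp_mem_FP (nthF_mem_FP 3) fstF_mem_FP)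 (comp_mem_FP (nthF_mem_FP 3) fstF_mem_FP))) (comp_mem_FP (nthF_mem_FP 1) fstF_mem_FP))) (comp_mem_FP sndF_mem_FP sndF_mem_FP))))) (comp_mem_FP stepsFn_mem_FP (fanoutFn_mem_FP (fanoutFn_mem_FP (comp_mem_FP (nthF_mem_FP 1) fstF_mem_FP) (fanoutFn_mem_FP (comp_mem_FP (sndPow_mem_FP 7) fstF_mem_FP) (fanoutFn_mem_FP (comp_mem_FP HashBricks.umulFn_mem_FP (fanoutFn_mem_FP (comp_mem_FP (nthF_mem_FP 1) fstF_mem_FP) (comp_mem_FP (nthF_mem_FP 0) fstF_mem_FP))) (comp_mem_FP (nthF_mem_FP 6) fstF_mem_FP)))) (comp_mem_FP takeFn_mem_FP (fanoutFn_mem_FP (comp_mem_FP HashBricks.umulFn_mem_FP (fanoutFn_mem_FP (comp_mem_FP (nthF_mem_FP 6) fstF_mem_FP) (comp_mem_FP appF_mem_FP (fanoutFn_mem_FP (comp_mem_FP (sndPow_mem_FP 7) fstF_mem_FP) (comp_mem_FP HashBricks.umulFn_mem_FP (fanoutFn_mem_FP (comp_mem_FP (nthF_mem_FP 1) fstF_mem_FP)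 (comp_mem_FP (nthF_mem_FP 0) fstF_mem_FP))))))) (comp_mem_FP dropFn_mem_FP (fanoutFn_mem_FP (comp_mem_FP appF_mem_FP (fanoutFn_mem_FP (comp_mem_FP appF_mem_FP (fanoutFn_mem_FP (comp_mem_FP appF_mem_FP (fanoutFn_mem_FP (comp_mem_FP appF_mem_FP (fanoutFn_mem_FP (comp_mem_FP appF_mem_FP (fanoutFn_mem_FP (comp_mem_FP appF_mem_FP (fanoutFn_mem_FP (comp_mem_FP (nthF_mem_FP 2) fstF_mem_FP) (comp_mem_FP HashBricks.umulFn_mem_FP (fanoutFn_mem_FP (comp_mem_FP (nthF_mem_FP 7) fstF_mem_FP) (comp_mem_FP (nthF_mem_FP 7) fstF_mem_FP))))) (comp_mem_FP (nthF_mem_FP 3) fstF_mem_FP))) (comp_mem_FP HashBricks.umulFn_mem_FP (fanoutFn_mem_FP (comp_mem_FP (nthF_mem_FP 4) fstF_mem_FP) (comp_mem_FP (nthF_mem_FP 1) fstF_mem_FP))))) (comp_mem_FP (nthF_mem_FP 4) fstF_mem_FP))) (comp_mem_FP (nthF_mem_FP 1) fstF_mem_FP))) (comp_mem_FP HashBricks.umulFn_mem_FP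 (fanoutFn_mem_FP (comp_mem_FP (nthF_mem_FP 1) fstF_mem_FP) (comp_mem_FP (nthF_mem_FP 0) fstF_mem_FP))))) (comp_mem_FP fstF_mem_FP sndF_mem_FP))))))))))))


/-! ### Values -/

section Values

variable {n k ℓ kk t q κ : ℕ}

/-- The steps context `⟨1ᵏ, ⟨1^κ, ⟨1^{kn}, 1ᵗ⟩⟩⟩`. [folklore] -/
def stepsCtx (n k t κ : ℕ) : List Bool := boolPair (ones k) (boolPair (ones κ) (boolPair (ones (k * n)) (ones t)))

/-- `tupleBits` of a tuple read bitwise is the slice. [folklore] -/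
theorem tupleBits_readTuple (seg : List Bool) (o : ℕ) (h : o + k * n ≤ seg.length) :
    tupleBits (fun (blk : Fin k) (d : Fin n) => seg.getD (o + (blk * n + d)) false) = (seg.drop o).take (k * n) := by
  rw [drop_take_eq_ofFn_readBits seg h, tupleBits]
  refine congrArg List.ofFn (funext fun p => ?_)
  simp only [readBits, finProdFinEquiv_symm_apply, Fin.coe_divNat, Fin.coe_modNat]
  congr 2
  exact Nat.div_add_mod' p n

/-- Value of `stepsPiece` (`r < t`, segment of the right length, `2^κ ≤ k`). [folklore] -/
theorem stepsPiece_apply (hκ : 2 ^ κ ≤ k) (stb : List Bool) (hlen : stb.length = t * stepLen n k κ) {r : ℕ} (hr : r < t) :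
    stepsPiece (boolPair (boolPair (stepsCtx n k t κ) stb) (ones r)) =
      boolPair (boolPair (ones (bitsToNat (List.ofFn (readBits stb (r * stepLen n k κ) κ)) % k))
        ((stb.drop (r * stepLen n k κ + κ)).take (k * n))) [] := by
  have hfit : r * stepLen n k κ + κ + k * n ≤ stb.length := by
    rw [hlen]
    have : (r + 1) * stepLen n k κ ≤ t * stepLen n k κ := Nat.mul_le_mul_right _ hr
    rw [Nat.succ_mul, stepLen] at this
    rw [stepLen]; omega
  have hj : bitsToNat (List.ofFn (readBits stb (r * stepLen n k κ) κ)) < k :=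
    lt_of_lt_of_le (by simpa using bitsToNat_lt (List.ofFn (readBits stb (r * stepLen n k κ) κ))) hκ
  rw [stepsPiece, fanoutFn_apply, fanoutFn_apply]
  simp only [Function.comp_apply, fanoutFn_apply, fstF_boolPair, sndF_boolPair, stepsCtx, nthF,
    HashBricks.umulFn_boolPair, appF_boolPair, ones_append_ones,
    length_ones, takeFn_boolPair, dropFn_boolPair, binToUnaryFn_boolPair]
  rw [show κ + k * n = stepLen n k κ from rfl, drop_take_eq_ofFn_readBits stb (by rw [stepLen] at hfit ⊢; omega),
    min_eq_left hj.le, Nat.mod_eq_of_lt hj]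

/-- The pieces of the steps fold have linear length. [folklore] -/
theorem length_stepsPiece_le (hκ : 2 ^ κ ≤ k) (hk : 0 < k) (stb : List Bool) (hlen : stb.length = t * stepLen n k κ)
    {r : ℕ} (hr : r < t) :
    (stepsPiece (boolPair (boolPair (stepsCtx n k t κ) stb) (ones r))).length ≤ 3 * ((boolPair (stepsCtx n k t κ) stb).length + 1) := by
  rw [stepsPiece_apply hκ stb hlen hr, length_boolPair, length_boolPair, length_ones, List.length_nil]
  have h1 : bitsToNat (List.ofFn (readBits stb (r * stepLen n k κ) κ)) % k < k := Nat.mod_lt _ hk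
  have h2 := List.length_take_le (k * n) (stb.drop (r * stepLen n k κ + κ))
  simp only [length_boolPair, stepsCtx, length_ones]
  omega

/-- **Value of `stepsFn`**: the list code `stepsCode` of the steps read off the segment. [folklore] -/
theorem stepsFn_apply (hκ : 2 ^ κ ≤ k) (hk : 0 < k) (stb : List Bool) (hlen : stb.length = t * stepLen n k κ) :
    stepsFn (boolPair (stepsCtx n k t κ) stb) =
      stepsCode (fun r : Fin t => ((⟨bitsToNat (List.ofFn (readBits stb (r * stepLen n k κ) κ)) % k, Nat.mod_lt _ hk⟩ : Fin k),
        fun (blk : Fin k) (d : Fin n) => stb.getD (r * stepLen n k κ + κ + (blk * n + d)) false)) := by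
  have ht : t ≤ X.eval (boolPair (stepsCtx n k t κ) stb).length := by
    rw [eval_X]; simp only [length_boolPair, stepsCtx, length_ones]; omega
  have hT : sndPow 2 (fstF (boolPair (stepsCtx n k t κ) stb)) = ones t := by simp [stepsCtx, sndPow]
  rw [stepsFn, Function.comp_apply, Function.comp_apply, fanoutFn_apply, fanoutFn_apply, id, Function.comp_apply,
    Function.comp_apply, hT, lenBinF_apply, length_ones,
    show (boolPair ([] : List Bool) []) = boolPair (ones 0) ([] : List Bool) by rfl,
    foldLoop_apply _ _ ht, foldAcc_clipF (fun r _ hr => by rw [zero_add] at hr; exact length_stepsPiece_le hκ hk stb hlen hr),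
    foldAcc_appF]
  simp only [sndPow, Function.comp_apply, sndF_boolPair, zero_add, List.nil_append, stepsCode]
  rw [ccat_congr (g' := fun r => if h : r < t then boolPair (boolPair
      (ones (bitsToNat (List.ofFn (readBits stb (r * stepLen n k κ) κ)) % k))
      (tupleBits fun (blk : Fin k) (d : Fin n) => stb.getD (r * stepLen n k κ + κ + (blk * n + d)) false)) [] else [])
    (fun r hr => by
      rw [dif_pos hr, stepsPiece_apply hκ stb hlen hr, tupleBits_readTuple]
      rw [hlen]
      have : (r + 1) * stepLen n k κ ≤ t * stepLen n k κ := Nat.mul_le_mul_right _ hr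
      rw [Nat.succ_mul, stepLen] at this
      rw [stepLen]; omega),
    ← flatten_ofFn_eq_ccat (fun r : Fin t => boolPair (boolPair
      (ones (bitsToNat (List.ofFn (readBits stb (r * stepLen n k κ) κ)) % k))
      (tupleBits fun (blk : Fin k) (d : Fin n) => stb.getD (r * stepLen n k κ + κ + (blk * n + d)) false)) []),
    flatten_ofFn_boolPair_nil]

/-- `seedBits` of seeds read bitwise off a slice of the right length is the slice. [folklore] -/
theorem seedBits_read (sl : List Bool) (hlen : sl.length = kk * k) :
    seedBits (fun (s : Fin kk) (p : Fin k) => boolToZMod (sl.getD (s * k + p) false)) = sl := by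
  rw [seedBits]
  apply List.ext_getElem
  · simp [hlen]
  · intro idx h1 h2
    rw [List.getElem_ofFn, zmodToBool_boolToZMod]
    simp only [finProdFinEquiv_symm_apply, Fin.coe_divNat, Fin.coe_modNat]
    rw [Nat.div_add_mod' idx k, List.getD_eq_getElem _ _ h2]

/-- The guess bits read off a slice of the right length are the slice. [folklore] -/
theorem ofFn_zmodToBool_read (sl : List Bool) (hlen : sl.length = kk) :
    (List.ofFn fun s : Fin kk => zmodToBool (boolToZMod (sl.getD s false))) = sl := by
  apply List.ext_getElem
  · simp [hlen]
  · intro s h1 h2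
    rw [List.getElem_ofFn, zmodToBool_boolToZMod, List.getD_eq_getElem _ _ h2]

/-- `tupleBits` of a tuple read off a slice of the right length is the slice. [folklore] -/
theorem tupleBits_read (sl : List Bool) (hlen : sl.length = k * n) :
    tupleBits (fun (blk : Fin k) (d : Fin n) => sl.getD (blk * n + d) false) = sl := by
  have := tupleBits_readTuple (k := k) (n := n) sl 0 (by omega)
  simp only [zero_add, List.drop_zero] at this
  rw [this, List.take_of_length_le (by omega)]

/-- The length of a slice inside the string. [folklore] -/
theorem length_slice {seg : List Bool} {o len : ℕ} (h : o + len ≤ seg.length) : (slice seg o len).length = len := by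
  simp [slice]; omega

/-- A slice inside the string lists `readBits`. [folklore] -/
theorem slice_eq_ofFn {seg : List Bool} {o len : ℕ} (h : o + len ≤ seg.length) :
    slice seg o len = List.ofFn (readBits seg o len) := drop_take_eq_ofFn_readBits seg h

end Values

/-! ### The value of `hypFn` -/

section HypValue

variable {q n k ℓ kk t κ : ℕ} [Fact q.Prime]

/-- **`hypFn` assembles the hypothesis record of the run.** On the parameter record, a coin
segment of length `runLen` and answers that are correct for the table queries (`AnswersOK`) and
for the trusted tuple, `hypFn` returns `hypRec [] q n k ℓ kk t tbls f (coinsToRun … seg)` with the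
learner's tables `tbls`. [cite: CarmosinoImpagliazzoKabanetsKolokolova2016, §5 (complete algorithm)] -/
theorem hypFn_apply (hn : k * n + k ≤ q) (hκ : 2 ^ κ ≤ k) (hk : 0 < k) (f : (Fin n → Bool) → Bool) (seg : List Bool)
    (hseg : seg.length = runLen n k ℓ kk t q κ) (ans : List Bool)
    (hansT : AnswersOK hn f (coinsToRun n k ℓ kk t q κ hk seg).1.1 (coinsToRun n k ℓ kk t q κ hk seg).1.2.1 ans)
    (hansV : (ans.drop (2 ^ ℓ * 2 ^ ℓ * k)).take k = List.ofFn (f ∘ (coinsToRun n k ℓ kk t q κ hk seg).2.2.2.1))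
    (hLk : 2 ^ ℓ ≤ ans.length) :
    hypFn (boolPair (prmRec n k ℓ (2 ^ ℓ) kk (2 ^ kk) t q κ) (boolPair seg ans)) =
      hypRec [] q n k ℓ kk t (List.ofFn fun j : Fin (2 ^ ℓ) => learnerTable hn f (coinsToRun n k ℓ kk t q κ hk seg).1.1 j
        (coinsToRun n k ℓ kk t q κ hk seg).1.2.1) f (coinsToRun n k ℓ kk t q κ hk seg) := by
  -- lengths (with `L = 2^ℓ` as an atom for `omega`)
  obtain ⟨L, hL⟩ : ∃ L, 2 ^ ℓ = L := ⟨_, rfl⟩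
  have hO : offSt n k ℓ kk q = ℓ + q * q + 2 ^ ℓ + kk * k + kk + k + k * n := rfl
  have hseg' : seg.length = ℓ + q * q + L + kk * k + kk + k + k * n + t * (κ + k * n) := by rw [hseg, ← hL]; rfl
  have b1 : 0 + ℓ ≤ seg.length := by omega
  have b2 : ℓ + q * q ≤ seg.length := by omega
  have b3 : ℓ + q * q + 2 ^ ℓ ≤ seg.length := by rw [hL]; omega
  have b4 : ℓ + q * q + 2 ^ ℓ + kk * k ≤ seg.length := by rw [hL]; omega
  have b5 : ℓ + q * q + 2 ^ ℓ + kk * k + kk ≤ seg.length := by rw [hL]; omega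
  have b6 : ℓ + q * q + 2 ^ ℓ + kk * k + kk + k ≤ seg.length := by rw [hL]; omega
  have b7 : ℓ + q * q + 2 ^ ℓ + kk * k + kk + k + k * n ≤ seg.length := by rw [hL]; omega
  have b8 : offSt n k ℓ kk q + t * stepLen n k κ ≤ seg.length := by rw [hO, stepLen, hL]; omega
  set ω := coinsToRun n k ℓ kk t q κ hk seg with hω
  -- the fields
  have hI : List.take ℓ (List.drop ([] : List Bool).length seg) = List.ofFn ((boolFunEquivFin ℓ).symm ω.1.1) := by
    rw [hω, coinsToRun]; dsimp only
    rw [Equiv.symm_apply_apply, List.length_nil, ← drop_take_eq_ofFn_readBits seg b1]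
  have hZ : List.take (q * q) (List.drop ℓ seg) = List.ofFn ω.1.2.1 := by
    rw [hω, coinsToRun]; dsimp only; rw [← drop_take_eq_ofFn_readBits seg b2]
  have hWw : List.take (2 ^ ℓ) (List.drop (ℓ + q * q) seg) = List.ofFn ω.1.2.2 := by
    rw [hω, coinsToRun]; dsimp only; rw [offW, ← drop_take_eq_ofFn_readBits seg b3]
  have hSd : List.take (kk * k) (List.drop (ℓ + q * q + 2 ^ ℓ) seg) = seedBits ω.2.1.1 := by
    rw [hω, coinsToRun]; dsimp only
    rw [seedBits_read _ (length_slice (by rw [offSd, offW]; exact b4)), slice, offSd, offW]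
  have hSg : List.take kk (List.drop (ℓ + q * q + 2 ^ ℓ + kk * k) seg) = List.ofFn fun s => zmodToBool (ω.2.1.2 s) := by
    rw [hω, coinsToRun]; dsimp only
    rw [ofFn_zmodToBool_read _ (length_slice (by rw [offSg, offSd, offW]; exact b5)), slice, offSg, offSd, offW]
  have hPb : List.take k (List.drop (ℓ + q * q + 2 ^ ℓ + kk * k + kk) seg) = List.ofFn ω.2.2.1 := by
    rw [hω, coinsToRun]; dsimp only; rw [offPb, offSg, offSd, offW, ← drop_take_eq_ofFn_readBits seg b6]
  have hA : List.take (k * n) (List.drop (ℓ + q * q + 2 ^ ℓ + kk * k + kk + k) seg) = tupleBits ω.2.2.2.1 := by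
    rw [hω, coinsToRun]; dsimp only
    rw [tupleBits_read _ (length_slice (by rw [offA, offPb, offSg, offSd, offW]; exact b7)), slice, offA, offPb, offSg, offSd, offW]
  have hSt : stepsFn (boolPair (boolPair (ones k) (boolPair (ones κ) (boolPair (ones (k * n)) (ones t))))
      (List.take (t * (κ + k * n)) (List.drop (ℓ + q * q + 2 ^ ℓ + kk * k + kk + k + k * n) seg))) = stepsCode ω.2.2.2.2 := by
    rw [show boolPair (ones k) (boolPair (ones κ) (boolPair (ones (k * n)) (ones t))) = stepsCtx n k t κ from rfl,
      show κ + k * n = stepLen n k κ from rfl,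
      show List.take (t * stepLen n k κ) (List.drop (ℓ + q * q + 2 ^ ℓ + kk * k + kk + k + k * n) seg) =
        slice seg (offSt n k ℓ kk q) (t * stepLen n k κ) by rw [slice, hO],
      stepsFn_apply hκ hk _ (length_slice b8), hω, coinsToRun]
  have hTb : tablesFn (boolPair (boolPair (boolPair [] (boolPair (ones q) (boolPair (ones ℓ) (boolPair (ones (k * n + k)) (ones (2 ^ ℓ))))))
      (boolPair (List.ofFn ((boolFunEquivFin ℓ).symm ω.1.1)) (boolPair (List.ofFn ω.1.2.1) (boolPair (ones n) (ones k))))) ans) =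
      OracleCompose.body (List.ofFn fun j : Fin (2 ^ ℓ) => learnerTable hn f ω.1.1 j ω.1.2.1) := by
    rw [show boolPair (boolPair (boolPair [] (boolPair (ones q) (boolPair (ones ℓ) (boolPair (ones (k * n + k)) (ones (2 ^ ℓ))))))
      (boolPair (List.ofFn ((boolFunEquivFin ℓ).symm ω.1.1)) (boolPair (List.ofFn ω.1.2.1) (boolPair (ones n) (ones k))))) ans =
      runCtx q n k ℓ (List.ofFn ((boolFunEquivFin ℓ).symm ω.1.1)) (List.ofFn ω.1.2.1) ans from rfl]
    exact tablesFn_apply hansT hLk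
  rw [hypFn]
  simp only [fanoutFn_apply, Function.comp_apply, fstF_boolPair, sndF_boolPair, prmRec, nthF, sndPow,
    HashBricks.umulFn_boolPair, appF_boolPair, ones_append_ones, takeFn_boolPair, dropFn_boolPair, length_ones]
  rw [hI, hZ, hWw, hSd, hSg, hPb, hA, hansV, hSt, hTb]
  rfl

end HypValue


end Literature.Computability.Learning
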